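import Literature.Barriers.CriticalPhenomena.GridSAWFormulaDrawing
import Literature.Barriers.CriticalPhenomena.GridSAWGridFormulaCellsFP
import Literature.Barriers.CriticalPhenomena.GridSAWGridFormulaGadgetsFP
import Literature.Barriers.CriticalPhenomena.GridSAWInstanceCodeFP
import Literature.Computability.Complexity.CodeFPArith
import Literature.Computability.Complexity.CodeFPListKit
import HarnessLib

/-!
# The drawing of the graph of a formula is polynomial-time computable

`codeFP_drawingData : CodeFP cnfC ndC (fun ψ => ((drawing ψ).verts, (drawing ψ).verts.map (drawing ψ).pos,
(drawing ψ).edges, 0, lastQ (cellsOf ψ)))` — the last hypothesis of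
`LOT2003_lemma4_gadgets_of_family` for the drawn family of `GridSAWFormulaDrawing.lean`.

The drawing is a list comprehension over the tiles of the picture: per tile, the parameters of its
bundle (`bspecAt`, a number `< 85`), the kinds of the bundle (a constant table), and per kind its
own vertices and wired edges (constant tables of references and local coordinates) translated to
the tile's anchor and named by closed arithmetic formulas (`gname`).  Everything is assembled from
the `CodeFP` combinators (`CodeFP.lean`, `CodeFPArith.lean`) and the polynomial-time primitives of
the abstract graph (`GridSAWGridFormulaCellsFP.lean`, `GridSAWGridFormulaGadgetsFP.lean`).

## References

* M. Liśkiewicz, M. Ogihara, S. Toda, TCS 304 (2003) 129–156, §4 (proof of Theorem 7: "E₀ is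
  computable in polynomial time").
* S. Arora, B. Barak, *Computational Complexity: A Modern Approach*, CUP 2009, §1.3.
-/

namespace Literature.Barriers.CriticalPhenomena.GridSAW

namespace FormulaDrawing

open _root_.Computability Polynomial Literature.Computability.Complexity Literature.Computability.Complexity.CodeFP
open Literature.Combinatorics.SimpleGraph Literature.Combinatorics.SimpleGraph.GridFormula
open Literature.Combinatorics.SimpleGraph.GridCell (CellTy conn vtx lastQ)
open GridFormulaFP

variable {β : Type} {eβ : β → List Bool}

/-! ### The parameters of a tile as numbers -/

section Params

/-- The code of the triple context `(ψ, i, jj)`. -/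
local notation "E3" => pairE cnfC (pairE natE natE)

/-- Tile kinds as numbers (`e ↦ 0`, `t ↦ 1`, `c ↦ 2`, agreeing with `tileTyN`). [folklore] -/
def TK3.n : TK3 → ℕ
  | .e => 0
  | .t => 1
  | .c => 2

/-- Roles as numbers. [folklore] -/
def Role.n : Role → ℕ
  | .or1 => 0
  | .or3a => 1
  | .or3b => 2
  | .or3c => 3

/-- `tk3` is `tileTyN` of the tile type. [folklore] -/
theorem tk3_n (ψ : CNF ℕ) (i j : ℕ) : (tk3 ψ i j).n = tileTyN (tileTy ψ i j) := by
  unfold tk3; cases tileTy ψ i j <;> rfl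

/-- **The parameters of a tile as one number `< 85`.** [folklore] -/
def BSpec.bnum : BSpec → ℕ
  | .tile tk w e ab => tk.n * 12 + (if w then 6 else 0) + (if e then 3 else 0) + ab.n
  | .clause l ab r e => 36 + (if l then 24 else 0) + ab.n * 8 + r.n * 2 + (if e then 1 else 0)
  | .doubler => 84

/-- Decoding a parameter number. [folklore] -/
def bdec (n : ℕ) : Option BSpec := (BSpec.all.filter fun b => b.bnum = n).head?

/-- `bdec` decodes `bnum`. [folklore] -/
theorem bdec_bnum : ∀ b ∈ BSpec.all, bdec b.bnum = some b := by decide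

/-- `bnum < 85`. [folklore] -/
theorem bnum_lt : ∀ b ∈ BSpec.all, b.bnum < 85 := by decide

variable (ψ : CNF ℕ)

/-- `tk3 · · .n` of a computed tile. [cite: AroraBarak2009, §1.3] -/
theorem codeFP_tk3n {i j : β → ℕ} {φ : β → CNF ℕ} (hφ : CodeFP eβ cnfC φ) (hi : CodeFP eβ natE i) (hj : CodeFP eβ natE j) :
    CodeFP eβ natE (fun b => (tk3 (φ b) (i b) (j b)).n) :=
  (codeFP_tileTyN.comp (hφ.pair (hi.pair hj))).congr fun b => by simp [tk3_n]

/-- The number of the clause of a column: `colClause ψ j`, counted by a list comprehension.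
[cite: AroraBarak2009, §1.3] -/
theorem colClause_eq (j : ℕ) :
    colClause ψ j = (((List.range ψ.length).map fun q => if cstart ψ (q + 1) ≤ j then [()] else []).flatten).length := by
  unfold colClause
  generalize List.range ψ.length = l
  induction l with
  | nil => rfl
  | cons q l ih =>
    by_cases h : cstart ψ (q + 1) ≤ j
    · simp [h, ih]
    · simp [h, ih]

/-- **The clause of a column** `(ψ, j) ↦ colClause ψ j`. [cite: AroraBarak2009, §1.3] -/
theorem codeFP_colClause : CodeFP (pairE cnfC natE) natE (fun p => colClause p.1 p.2) := by
  -- items `q` over the context `(ψ, j)`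
  have hitem : CodeFP (pairE (pairE cnfC natE) natE) (rawE unitE)
      (fun t => if cstart t.1.1 (t.2 + 1) ≤ t.1.2 then [()] else []) := by
    have hc : CodeFP (pairE (pairE cnfC natE) natE) natE (fun t => cstart t.1.1 (t.2 + 1)) :=
      codeFP_cstart.comp ((fst _ _).fst'.pair ((natAdd.comp ((snd _ _).pair (const _ 1))).congr fun _ => rfl))
    have hb : CodeFP (pairE (pairE cnfC natE) natE) bitE (fun t => decide (cstart t.1.1 (t.2 + 1) ≤ t.1.2)) :=
      (natLe.comp (hc.pair (fst _ _).snd')).congr fun _ => rfl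
    exact (hb.ite (const _ [()]) (const _ [])).congr fun t => by
      by_cases h : cstart t.1.1 (t.2 + 1) ≤ t.1.2 <;> simp [h]
  have hr : CodeFP (pairE cnfC natE) (rawE natE) (fun p => List.range p.1.length) :=
    (urange.comp ((ulength clauseC).comp ((rawOfList clauseC).comp (fst _ _)))).congr fun _ => rfl
  have hm := (map (σ := CNF ℕ × ℕ) (eσ := pairE cnfC natE) hitem).comp ((CodeFP.id _).pair hr)
  exact ((natLength unitE).comp ((flatten unitE).comp hm)).congr fun p => by rw [colClause_eq]; rfl

/-- The length of the clause `getD`. [folklore] -/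
theorem length_getD_eq (q : ℕ) : (ψ.getD q []).length = (ψ.map List.length).getD q 0 := by
  rcases Nat.lt_or_ge q ψ.length with h | h
  · rw [List.getD_eq_getElem _ _ h, List.getD_eq_getElem _ _ (by simpa using h), List.getElem_map]
  · rw [List.getD_eq_default _ _ h, List.getD_eq_default _ _ (by simpa using h)]; rfl

/-- The role number by cases. [folklore] -/
theorem roleN_eq (j : ℕ) : (roleOf ψ j).n =
    if (ψ.map List.length).getD (colClause ψ j) 0 = 1 then 0
    else if j - cstart ψ (colClause ψ j) = 0 then 1 else if j - cstart ψ (colClause ψ j) = 1 then 2 else 3 := by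
  unfold roleOf; rw [length_getD_eq]
  by_cases h1 : (ψ.map List.length).getD (colClause ψ j) 0 = 1
  · rw [if_pos h1, if_pos h1]; rfl
  · rw [if_neg h1, if_neg h1]
    by_cases h2 : j - cstart ψ (colClause ψ j) = 0
    · rw [if_pos h2]; simp only [h2]; rfl
    · rw [if_neg h2]
      by_cases h3 : j - cstart ψ (colClause ψ j) = 1
      · rw [if_pos h3]; simp only [h3]; rfl
      · rw [if_neg h3]
        obtain ⟨n, hn⟩ : ∃ n, j - cstart ψ (colClause ψ j) = n + 2 := ⟨j - cstart ψ (colClause ψ j) - 2, by omega⟩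
        simp only [hn]; rfl

/-- **The role of a column as a number** `(ψ, j) ↦ (roleOf ψ j).n`. [cite: AroraBarak2009, §1.3] -/
theorem codeFP_roleN : CodeFP (pairE cnfC natE) natE (fun p => (roleOf p.1 p.2).n) := by
  have hq : CodeFP (pairE cnfC natE) natE (fun p => colClause p.1 p.2) := codeFP_colClause
  have hlen : CodeFP (pairE cnfC natE) natE (fun p => (p.1.map List.length).getD (colClause p.1 p.2) 0) :=
    codeFP_clauseLen.comp ((fst _ _).pair hq)
  have hd : CodeFP (pairE cnfC natE) natE (fun p => p.2 - cstart p.1 (colClause p.1 p.2)) :=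
    natSub.comp ((snd _ _).pair (codeFP_cstart.comp ((fst _ _).pair hq)))
  have h1 : CodeFP (pairE cnfC natE) bitE (fun p => decide ((p.1.map List.length).getD (colClause p.1 p.2) 0 = 1)) :=
    (natEq.comp (hlen.pair (const _ 1))).congr fun _ => rfl
  have h0 : CodeFP (pairE cnfC natE) bitE (fun p => decide (p.2 - cstart p.1 (colClause p.1 p.2) = 0)) :=
    (natEq.comp (hd.pair (const _ 0))).congr fun _ => rfl
  have h1' : CodeFP (pairE cnfC natE) bitE (fun p => decide (p.2 - cstart p.1 (colClause p.1 p.2) = 1)) :=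
    (natEq.comp (hd.pair (const _ 1))).congr fun _ => rfl
  exact (h1.ite (const _ 0) (h0.ite (const _ 1) (h1'.ite (const _ 2) (const _ 3)))).congr fun p => by
    rw [roleN_eq]; simp only [decide_eq_true_eq]

/-- **The landing-parity bit of a column** `(ψ, j) ↦ land3 ψ j`. [cite: AroraBarak2009, §1.3] -/
theorem codeFP_land3 : CodeFP (pairE cnfC natE) bitE (fun p => land3 p.1 p.2) :=
  (natEq.comp (codeFP_landSlotN.pair (const _ (slotN Slot.bN3)))).congr fun p => by
    unfold land3
    by_cases h : landSlot p.1 p.2 = Slot.bN3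
    · simp [h]
    · simp only [h, decide_false, decide_eq_false_iff_not]
      exact fun h' => h (slotN_injective h')

/-- **The parameter number of a tile of the picture** `(ψ, i, jj) ↦ (bspecAt ψ i jj).bnum`.
[cite: AroraBarak2009, §1.3] -/
theorem codeFP_bnum : CodeFP E3 natE (fun p => (bspecAt p.1 p.2.1 p.2.2).bnum) := by
  have hψ : CodeFP E3 cnfC (fun p => p.1) := fst _ _
  have hi : CodeFP E3 natE (fun p => p.2.1) := (snd _ _).fst'
  have hjj : CodeFP E3 natE (fun p => p.2.2) := (snd _ _).snd'
  have hV : CodeFP E3 natE (fun p => V p.1) := codeFP_V.comp hψ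
  have hN : CodeFP E3 natE (fun p => N p.1) := codeFP_N.comp hψ
  have hj1 : CodeFP E3 natE (fun p => p.2.2 - 1) := natSub.comp (hjj.pair (const _ 1))
  have hi1 : CodeFP E3 natE (fun p => p.2.1 - 1) := natSub.comp (hi.pair (const _ 1))
  have hV1 : CodeFP E3 natE (fun p => V p.1 - 1) := natSub.comp (hV.pair (const _ 1))
  have htk : CodeFP E3 natE (fun p => (tk3 p.1 p.2.1 (p.2.2 - 1)).n) := codeFP_tk3n hψ hi hj1
  have hab' : CodeFP E3 natE (fun p => (tk3 p.1 (p.2.1 - 1) (p.2.2 - 1)).n) := codeFP_tk3n hψ hi1 hj1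
  have habc : CodeFP E3 natE (fun p => (tk3 p.1 (V p.1 - 1) (p.2.2 - 1)).n) := codeFP_tk3n hψ hV1 hj1
  have hi0 : CodeFP E3 bitE (fun p => decide (p.2.1 = 0)) := (natEq.comp (hi.pair (const _ 0))).congr fun _ => rfl
  have hab : CodeFP E3 natE (fun p => (if p.2.1 = 0 then TK3.e else tk3 p.1 (p.2.1 - 1) (p.2.2 - 1)).n) :=
    (hi0.ite (const _ 0) hab').congr fun p => by by_cases h : p.2.1 = 0 <;> simp [h, TK3.n]
  have hw : CodeFP E3 natE (fun p => if decide (2 ≤ p.2.2) then 6 else 0) :=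
    (((natLe.comp ((const _ 2).pair hjj)).congr fun _ => rfl).ite (const _ 6) (const _ 0))
  have he : CodeFP E3 natE (fun p => if decide (p.2.2 < N p.1) then 3 else 0) :=
    (((natLt.comp (hjj.pair hN)).congr fun _ => rfl).ite (const _ 3) (const _ 0))
  have he1 : CodeFP E3 natE (fun p => if decide (p.2.2 < N p.1) then 1 else 0) :=
    (((natLt.comp (hjj.pair hN)).congr fun _ => rfl).ite (const _ 1) (const _ 0))
  have hl : CodeFP E3 natE (fun p => if land3 p.1 (p.2.2 - 1) then 24 else 0) :=
    (codeFP_land3.comp (hψ.pair hj1)).ite (const _ 24) (const _ 0)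
  have hr : CodeFP E3 natE (fun p => (roleOf p.1 (p.2.2 - 1)).n) := codeFP_roleN.comp (hψ.pair hj1)
  -- the three branches
  have htile : CodeFP E3 natE (fun p => (tk3 p.1 p.2.1 (p.2.2 - 1)).n * 12 + (if decide (2 ≤ p.2.2) then 6 else 0) +
      (if decide (p.2.2 < N p.1) then 3 else 0) + (if p.2.1 = 0 then TK3.e else tk3 p.1 (p.2.1 - 1) (p.2.2 - 1)).n) :=
    natAdd.comp ((natAdd.comp ((natAdd.comp ((natMul.comp (htk.pair (const _ 12))).pair hw)).pair he)).pair hab)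
  have hclause : CodeFP E3 natE (fun p => 36 + (if land3 p.1 (p.2.2 - 1) then 24 else 0) +
      (tk3 p.1 (V p.1 - 1) (p.2.2 - 1)).n * 8 + (roleOf p.1 (p.2.2 - 1)).n * 2 + (if decide (p.2.2 < N p.1) then 1 else 0)) :=
    natAdd.comp ((natAdd.comp ((natAdd.comp ((natAdd.comp ((const _ 36).pair hl)).pair
      (natMul.comp (habc.pair (const _ 8))))).pair (natMul.comp (hr.pair (const _ 2))))).pair he1)
  have hj0 : CodeFP E3 bitE (fun p => decide (p.2.2 = 0)) := (natEq.comp (hjj.pair (const _ 0))).congr fun _ => rfl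
  have hiV : CodeFP E3 bitE (fun p => decide (p.2.1 < V p.1)) := (natLt.comp (hi.pair hV)).congr fun _ => rfl
  exact (hj0.ite (const _ 84) (hiV.ite htile hclause)).congr fun p => by
    obtain ⟨ψ, i, jj⟩ := p
    simp only
    unfold bspecAt
    by_cases h0 : jj = 0
    · simp [h0, BSpec.bnum]
    · by_cases hiv : i < V ψ <;> simp [h0, hiv, BSpec.bnum]

end Params

/-! ### Kinds as numbers and the constant tables -/

section Tables

/-- The index of a kind in `Kind.all`. [folklore] -/
def kidx (κ : Kind) : ℕ := Kind.all.idxOf κ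

/-- `kidx` is a valid index. [folklore] -/
theorem kidx_lt (κ : Kind) : kidx κ < Kind.all.length := List.idxOf_lt_length_iff.2 (Kind.mem_all κ)

/-- Table lookup by `kidx`. [folklore] -/
theorem getD_map_kidx {γ : Type} (F : Kind → γ) (d : γ) (κ : Kind) : (Kind.all.map F).getD (kidx κ) d = F κ := by
  rw [List.getD_eq_getElem _ _ (by simpa using kidx_lt κ), List.getElem_map]
  congr 1
  exact List.getElem_idxOf (kidx_lt κ)

/-- **The table of the bundles**, by parameter number, as kind indices. [folklore] -/
def bundleTbl : List (List ℕ) := (List.range 85).map fun n => ((bdec n).map fun b => b.bundle.map kidx).getD []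

/-- The bundle table row of a parameter value. [folklore] -/
theorem bundleTbl_getD (b : BSpec) : bundleTbl.getD b.bnum [] = b.bundle.map kidx := by
  unfold bundleTbl
  rw [List.getD_eq_getElem _ _ (by simpa using bnum_lt b (BSpec.mem_all b)), List.getElem_map, List.getElem_range,
    bdec_bnum b (BSpec.mem_all b)]
  rfl

variable (ψ : CNF ℕ)

/-- **The objects as numbers**: kind index and tile. [folklore] -/
def objsN : List (ℕ × ℕ × ℕ) :=
  (tcoords ψ).flatMap fun t => (bundleTbl.getD (bspecAt ψ t.1 t.2).bnum []).map fun k => (k, t.1, t.2)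

/-- `objsN` is `objs` with kinds replaced by their indices. [folklore] -/
theorem objsN_eq : objsN ψ = (objs ψ).map fun o => (kidx o.1, o.2.1, o.2.2) := by
  unfold objsN objs
  rw [List.map_flatMap]
  congr 1
  funext t
  rw [bundleTbl_getD, List.map_map, List.map_map]
  rfl

/-- **The tile coordinates are computable.** [cite: AroraBarak2009, §1.3] -/
theorem codeFP_tcoords : CodeFP cnfC (rawE (pairE natE natE)) tcoords := by
  -- inner items `j` over the context `(ψ, i)`; outer items `i` over the context `ψ`
  have hinner : CodeFP (pairE (pairE cnfC natE) natE) (pairE natE natE) (fun t => (t.1.2, t.2 + 1)) :=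
    (fst _ _).snd'.pair (natAdd.comp ((snd _ _).pair (const _ 1)))
  have hrowItems : CodeFP (pairE cnfC natE) (rawE natE) (fun q => List.range (N q.1)) :=
    urange.comp (codeFP_uN.comp (fst _ _))
  have hrow : CodeFP (pairE cnfC natE) (rawE (pairE natE natE)) (fun q => (List.range (N q.1)).map fun j => (q.2, j + 1)) :=
    ((map (σ := CNF ℕ × ℕ) (eσ := pairE cnfC natE) hinner).comp ((CodeFP.id _).pair hrowItems)).congr fun _ => rfl
  have hrows : CodeFP cnfC (rawE natE) (fun ψ => List.range (V ψ + 1)) :=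
    (urange.comp (unSucc.comp codeFP_uV)).congr fun _ => rfl
  have hm : CodeFP cnfC (rawE (rawE (pairE natE natE)))
      (fun ψ => (List.range (V ψ + 1)).map fun i => (List.range (N ψ)).map fun j => (i, j + 1)) :=
    ((map (σ := CNF ℕ) (eσ := cnfC) hrow).comp ((CodeFP.id _).pair hrows)).congr fun _ => rfl
  have hf : CodeFP cnfC (rawE (pairE natE natE))
      (fun ψ => (List.range (V ψ + 1)).flatMap fun i => (List.range (N ψ)).map fun j => (i, j + 1)) :=
    ((flatten _).comp hm).congr fun ψ => by simp [List.flatMap_def]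
  exact ((rawCons _).comp ((const _ ((0 : ℕ), (0 : ℕ))).pair hf)).congr fun ψ => rfl

/-- The code of the triple context `(ψ, i, jj)`. -/
local notation "E3" => pairE cnfC (pairE natE natE)

/-- **The object list is computable.** [cite: AroraBarak2009, §1.3] -/
theorem codeFP_objsN : CodeFP cnfC (rawE (pairE natE (pairE natE natE))) objsN := by
  -- per tile `t` (context `ψ`): the bundle row, then tag each kind index with the tile
  have hrowOf : CodeFP E3 (rawE natE) (fun p => bundleTbl.getD (bspecAt p.1 p.2.1 p.2.2).bnum []) :=
    (rawGetD (rawE natE) (d := []) rfl).comp ((const _ bundleTbl).pair codeFP_bnum)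
  have htag : CodeFP (pairE E3 natE) (pairE natE (pairE natE natE)) (fun q => (q.2, q.1.2.1, q.1.2.2)) :=
    (snd _ _).pair ((fst _ _).snd'.fst'.pair (fst _ _).snd'.snd')
  have hper : CodeFP E3 (rawE (pairE natE (pairE natE natE)))
      (fun p => (bundleTbl.getD (bspecAt p.1 p.2.1 p.2.2).bnum []).map fun k => (k, p.2.1, p.2.2)) :=
    ((map (σ := CNF ℕ × ℕ × ℕ) (eσ := E3) htag).comp ((CodeFP.id _).pair hrowOf)).congr fun _ => rfl
  have hm : CodeFP cnfC (rawE (rawE (pairE natE (pairE natE natE))))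
      (fun ψ => (tcoords ψ).map fun t => (bundleTbl.getD (bspecAt ψ t.1 t.2).bnum []).map fun k => (k, t.1, t.2)) :=
    ((map (σ := CNF ℕ) (eσ := cnfC) hper).comp ((CodeFP.id _).pair codeFP_tcoords)).congr fun _ => rfl
  exact ((flatten _).comp hm).congr fun ψ => by simp [objsN, List.flatMap_def]

end Tables

/-! ### Names -/

section Names

variable (ψ : CNF ℕ)

/-- A reference as numbers: tag (`0` cell, `1` gadget), tile offset, and the two indices. [folklore] -/
abbrev RefN : Type := ℕ × ℤ × ℤ × ℕ × ℕ

/-- The code of a numeric reference. [folklore] -/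
abbrev refE : RefN → List Bool := pairE natE (pairE intE (pairE intE (pairE natE natE)))

/-- A reference as numbers. [folklore] -/
def Ref.toN : Ref → RefN
  | .cell di dj c l => (0, di, dj, c, l)
  | .gad di dj f idx => (1, di, dj, f, idx)

/-- **The global name of a numeric reference** seen from tile `(i, jj)` (`gname` on numbers). [folklore] -/
def gnameN (i jj : ℕ) (r : RefN) : ℕ :=
  if r.1 = 0 then 17 * cellAt ψ (i + r.2.1) (jj + r.2.2.1) r.2.2.2.1 + r.2.2.2.2
  else gbase ψ (gadAt ψ (i + r.2.1) (jj + r.2.2.1) r.2.2.2.1) + r.2.2.2.2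

/-- `gname` is `gnameN` of the numeric reference. [folklore] -/
theorem gname_eq (i jj : ℕ) (r : Ref) : gname ψ i jj r = gnameN ψ i jj r.toN := by
  cases r <;> rfl

/-- The code of the context `(ψ, I, J, c)` of `cellAt`/`gadAt`. -/
local notation "E4" => pairE cnfC (pairE intE (pairE intE natE))

/-- **`cellAt` is computable.** [cite: AroraBarak2009, §1.3] -/
theorem codeFP_cellAt : CodeFP E4 natE (fun p => cellAt p.1 p.2.1 p.2.2.1 p.2.2.2) := by
  have hψ : CodeFP E4 cnfC (fun p => p.1) := fst _ _
  have hI : CodeFP E4 intE (fun p => p.2.1) := (snd _ _).fst'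
  have hJ : CodeFP E4 intE (fun p => p.2.2.1) := (snd _ _).snd'.fst'
  have hc : CodeFP E4 natE (fun p => p.2.2.2) := (snd _ _).snd'.snd'
  have hJ0 : CodeFP E4 bitE (fun p => decide (p.2.2.1 ≤ 0)) := (intLe.comp (hJ.pair (const _ (0 : ℤ)))).congr fun _ => rfl
  have hIV : CodeFP E4 bitE (fun p => decide (p.2.1 < (V p.1 : ℤ))) :=
    (intLt.comp (hI.pair (intOfNat.comp (codeFP_V.comp hψ)))).congr fun _ => rfl
  have hIn : CodeFP E4 natE (fun p => p.2.1.toNat) := intToNat.comp hI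
  have hJn : CodeFP E4 natE (fun p => p.2.2.1.toNat - 1) := natSub.comp ((intToNat.comp hJ).pair (const _ 1))
  have ht : CodeFP E4 natE (fun p => tileCell p.1 p.2.1.toNat (p.2.2.1.toNat - 1) p.2.2.2) :=
    (codeFP_tileCell.comp (hψ.pair (hIn.pair (hJn.pair hc)))).congr fun _ => rfl
  have hb : CodeFP E4 natE (fun p => clauseBead p.1 (p.2.2.1.toNat - 1)) :=
    (codeFP_clauseBead.comp (hψ.pair hJn)).congr fun _ => rfl
  exact (hJ0.ite (const _ 0) (hIV.ite ht hb)).congr fun p => by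
    unfold cellAt; simp only [decide_eq_true_eq]

/-- **`gadAt` is computable.** [cite: AroraBarak2009, §1.3] -/
theorem codeFP_gadAt : CodeFP E4 natE (fun p => gadAt p.1 p.2.1 p.2.2.1 p.2.2.2) := by
  have hψ : CodeFP E4 cnfC (fun p => p.1) := fst _ _
  have hI : CodeFP E4 intE (fun p => p.2.1) := (snd _ _).fst'
  have hJ : CodeFP E4 intE (fun p => p.2.2.1) := (snd _ _).snd'.fst'
  have hf : CodeFP E4 natE (fun p => p.2.2.2) := (snd _ _).snd'.snd'
  have hN : CodeFP E4 natE (fun p => N p.1) := codeFP_N.comp hψ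
  have hVN : CodeFP E4 natE (fun p => V p.1 * N p.1) := natMul.comp ((codeFP_V.comp hψ).pair hN)
  have hIn : CodeFP E4 natE (fun p => p.2.1.toNat) := intToNat.comp hI
  have hJn : CodeFP E4 natE (fun p => p.2.2.1.toNat - 1) := natSub.comp ((intToNat.comp hJ).pair (const _ 1))
  have h5 : CodeFP E4 bitE (fun p => decide (p.2.2.2 ≤ 5)) := (natLe.comp (hf.pair (const _ 5))).congr fun _ => rfl
  have h6 : CodeFP E4 bitE (fun p => decide (p.2.2.2 = 6)) := (natEq.comp (hf.pair (const _ 6))).congr fun _ => rfl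
  have hA : CodeFP E4 natE (fun p => 8 * (p.2.1.toNat * N p.1 + (p.2.2.1.toNat - 1)) + p.2.2.2) :=
    natAdd.comp ((natMul.comp ((const _ 8).pair (natAdd.comp ((natMul.comp (hIn.pair hN)).pair hJn)))).pair hf)
  have hB : CodeFP E4 natE (fun p => 8 * (V p.1 * N p.1) + (p.2.2.1.toNat - 1)) :=
    natAdd.comp ((natMul.comp ((const _ 8).pair hVN)).pair hJn)
  have hC : CodeFP E4 natE (fun p => 8 * (V p.1 * N p.1) + N p.1 + colClause p.1 (p.2.2.1.toNat - 1)) :=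
    natAdd.comp ((natAdd.comp ((natMul.comp ((const _ 8).pair hVN)).pair hN)).pair (codeFP_colClause.comp (hψ.pair hJn)))
  exact (h5.ite hA (h6.ite hB hC)).congr fun p => by
    unfold gadAt; simp only [decide_eq_true_eq]

/-- The code of the context `((ψ, i, jj), r)` of `gnameN`. -/
local notation "E3" => pairE cnfC (pairE natE natE)

/-- **`gnameN` is computable.** [cite: AroraBarak2009, §1.3] -/
theorem codeFP_gnameN : CodeFP (pairE E3 refE) natE (fun q => gnameN q.1.1 q.1.2.1 q.1.2.2 q.2) := by
  have hψ : CodeFP (pairE E3 refE) cnfC (fun q => q.1.1) := (fst _ _).fst'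
  have hi : CodeFP (pairE E3 refE) natE (fun q => q.1.2.1) := (fst _ _).snd'.fst'
  have hjj : CodeFP (pairE E3 refE) natE (fun q => q.1.2.2) := (fst _ _).snd'.snd'
  have htag : CodeFP (pairE E3 refE) natE (fun q => q.2.1) := (snd _ _).fst'
  have hdi : CodeFP (pairE E3 refE) intE (fun q => q.2.2.1) := (snd _ _).snd'.fst'
  have hdj : CodeFP (pairE E3 refE) intE (fun q => q.2.2.2.1) := (snd _ _).snd'.snd'.fst'
  have ha : CodeFP (pairE E3 refE) natE (fun q => q.2.2.2.2.1) := (snd _ _).snd'.snd'.snd'.fst'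
  have hb : CodeFP (pairE E3 refE) natE (fun q => q.2.2.2.2.2) := (snd _ _).snd'.snd'.snd'.snd'
  have hI : CodeFP (pairE E3 refE) intE (fun q => (q.1.2.1 : ℤ) + q.2.2.1) := (intAdd.comp ((intOfNat.comp hi).pair hdi)).congr fun _ => rfl
  have hJ : CodeFP (pairE E3 refE) intE (fun q => (q.1.2.2 : ℤ) + q.2.2.2.1) := (intAdd.comp ((intOfNat.comp hjj).pair hdj)).congr fun _ => rfl
  have hcellAt : CodeFP (pairE E3 refE) natE (fun q => cellAt q.1.1 ((q.1.2.1 : ℤ) + q.2.2.1) ((q.1.2.2 : ℤ) + q.2.2.2.1) q.2.2.2.2.1) :=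
    (codeFP_cellAt.comp (hψ.pair (hI.pair (hJ.pair ha)))).congr fun _ => rfl
  have hcell : CodeFP (pairE E3 refE) natE (fun q => 17 * cellAt q.1.1 ((q.1.2.1 : ℤ) + q.2.2.1) ((q.1.2.2 : ℤ) + q.2.2.2.1) q.2.2.2.2.1 + q.2.2.2.2.2) :=
    (natAdd.comp ((natMul.comp ((const _ 17).pair hcellAt)).pair hb)).congr fun _ => rfl
  have hgadAt : CodeFP (pairE E3 refE) natE (fun q => gadAt q.1.1 ((q.1.2.1 : ℤ) + q.2.2.1) ((q.1.2.2 : ℤ) + q.2.2.2.1) q.2.2.2.2.1) :=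
    (codeFP_gadAt.comp (hψ.pair (hI.pair (hJ.pair ha)))).congr fun _ => rfl
  have hnc : CodeFP (pairE E3 refE) natE (fun q => ncells q.1.1) := (codeFP_ncells.comp hψ).congr fun _ => rfl
  have hgad : CodeFP (pairE E3 refE) natE (fun q => gbase q.1.1 (gadAt q.1.1 ((q.1.2.1 : ℤ) + q.2.2.1) ((q.1.2.2 : ℤ) + q.2.2.2.1) q.2.2.2.2.1) + q.2.2.2.2.2) :=
    (natAdd.comp ((natAdd.comp ((natMul.comp ((const _ 17).pair hnc)).pair
      (natMul.comp ((const _ 64).pair hgadAt)))).pair hb)).congr fun _ => by simp [gbase]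
  have h0 : CodeFP (pairE E3 refE) bitE (fun q => decide (q.2.1 = 0)) := (natEq.comp (htag.pair (const _ 0))).congr fun _ => rfl
  exact (h0.ite hcell hgad).congr fun q => by
    unfold gnameN; simp only [decide_eq_true_eq]

end Names

/-! ### Per-object lists from the constant tables -/

section Objects

/-- The code of a point with integer coordinates (internal). [folklore] -/
abbrev ptE : GridPoint → List Bool := pairE intE intE

/-- **The own vertices of the kinds** (numeric references, local positions), by kind index. [folklore] -/
def vertsTbl : List (List (RefN × GridPoint)) := Kind.all.map fun κ => (Kind.verts κ).map fun a => (a.1.toN, a.2)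

/-- **The wired edges of the kinds** (numeric end references, EXPANDED local paths), by kind index. [folklore] -/
def wedgesTbl : List (List (RefN × RefN × List GridPoint)) :=
  Kind.all.map fun κ => (Kind.wedges κ).map fun e => (e.1.toN, e.2.1.toN, poly e.2.2)

variable (ψ : CNF ℕ)

/-- The own vertex names of a numeric object. [folklore] -/
def overtsN (o : ℕ × ℕ × ℕ) : List ℕ := (vertsTbl.getD o.1 []).map fun a => gnameN ψ o.2.1 o.2.2 a.1

/-- The (name, position) list of a numeric object. [folklore] -/
def ovposN (o : ℕ × ℕ × ℕ) : List (ℕ × GridPoint) :=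
  (vertsTbl.getD o.1 []).map fun a => (gnameN ψ o.2.1 o.2.2 a.1, shiftPt (anchor ψ o.2.1 o.2.2) a.2)

/-- The drawn edges of a numeric object. [folklore] -/
def oedgesN (o : ℕ × ℕ × ℕ) : List (SEdge ℕ) :=
  (wedgesTbl.getD o.1 []).map fun e => (gnameN ψ o.2.1 o.2.2 e.1, gnameN ψ o.2.1 o.2.2 e.2.1, e.2.2.map (shiftPt (anchor ψ o.2.1 o.2.2)))

/-- `overts` through the tables. [folklore] -/
theorem overts_eq (o : Obj) : overts ψ o = overtsN ψ (kidx o.1, o.2.1, o.2.2) := by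
  unfold overts overtsN vertsTbl Kind.ownKeys oname
  simp only
  rw [getD_map_kidx, List.map_map, List.map_map]
  congr 1
  funext a
  simp [gname_eq]

/-- The position entries of an object through the tables. [folklore] -/
theorem ovpos_eq (o : Obj) :
    (o.1.verts.map fun a => (oname ψ o a.1, shiftPt (oanchor ψ o) a.2)) = ovposN ψ (kidx o.1, o.2.1, o.2.2) := by
  unfold ovposN vertsTbl oname oanchor
  simp only
  rw [getD_map_kidx, List.map_map]
  congr 1
  funext a
  simp [gname_eq]

/-- `oedges` through the tables. [folklore] -/
theorem oedges_eq (o : Obj) : oedges ψ o = oedgesN ψ (kidx o.1, o.2.1, o.2.2) := by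
  unfold oedges oedgesN wedgesTbl oname oanchor
  simp only
  rw [getD_map_kidx, List.map_map]
  congr 1
  funext e
  simp [gname_eq]

/-- The code of the triple context `(ψ, i, jj)`. -/
local notation "E3" => pairE cnfC (pairE natE natE)

/-- **The anchor is computable.** [cite: AroraBarak2009, §1.3] -/
theorem codeFP_anchor : CodeFP E3 ptE (fun p => anchor p.1 p.2.1 p.2.2) := by
  have hV : CodeFP E3 natE (fun p => V p.1) := codeFP_V.comp (fst _ _)
  have hi : CodeFP E3 natE (fun p => p.2.1) := (snd _ _).fst'
  have hjj : CodeFP E3 natE (fun p => p.2.2) := (snd _ _).snd'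
  have h4V : CodeFP E3 natE (fun p => 4 * V p.1) := natMul.comp ((const _ 4).pair hV)
  have hx : CodeFP E3 natE (fun p => 4 * V p.1 + 40 + 117 * p.2.2) :=
    natAdd.comp ((natAdd.comp (h4V.pair (const _ 40))).pair (natMul.comp ((const _ 117).pair hjj)))
  have hy : CodeFP E3 natE (fun p => 4 * V p.1 + 20 + 160 * (V p.1 - p.2.1)) :=
    natAdd.comp ((natAdd.comp (h4V.pair (const _ 20))).pair (natMul.comp ((const _ 160).pair (natSub.comp (hV.pair hi)))))
  exact ((intOfNat.comp hx).pair (intOfNat.comp hy)).congr fun p => by unfold anchor; rfl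

/-- The code of the object context `(ψ, k, i, jj)`. -/
local notation "OE" => pairE cnfC (pairE natE (pairE natE natE))

/-- From the object context to the tile context. [folklore] -/
private theorem obj_E3 : CodeFP OE E3 (fun o => (o.1, o.2.2.1, o.2.2.2)) :=
  (fst _ _).pair ((snd _ _).snd'.fst'.pair (snd _ _).snd'.snd')

/-- **Translation of a local point** in the object context. [cite: AroraBarak2009, §1.3] -/
theorem codeFP_shift : CodeFP (pairE OE ptE) ptE (fun q => shiftPt (anchor q.1.1 q.1.2.2.1 q.1.2.2.2) q.2) := by
  have ha : CodeFP (pairE OE ptE) ptE (fun q => anchor q.1.1 q.1.2.2.1 q.1.2.2.2) :=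
    (codeFP_anchor.comp (obj_E3.comp (fst _ _))).congr fun _ => rfl
  have hp : CodeFP (pairE OE ptE) ptE (fun q => q.2) := snd _ _
  exact ((intAdd.comp (hp.fst'.pair ha.fst')).pair (intAdd.comp (hp.snd'.pair ha.snd'))).congr fun q => by
    unfold shiftPt; rfl

/-- **A name in the object context.** [cite: AroraBarak2009, §1.3] -/
theorem codeFP_gnameO : CodeFP (pairE OE refE) natE (fun q => gnameN q.1.1 q.1.2.2.1 q.1.2.2.2 q.2) :=
  (codeFP_gnameN.comp ((obj_E3.comp (fst _ _)).pair (snd _ _))).congr fun _ => rfl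

/-- The vertex table row of an object. [cite: AroraBarak2009, §1.3] -/
theorem codeFP_vertsRow : CodeFP OE (rawE (pairE refE ptE)) (fun o => vertsTbl.getD o.2.1 []) :=
  (rawGetD (rawE (pairE refE ptE)) (d := []) rfl).comp ((const _ vertsTbl).pair (snd _ _).fst')

/-- The edge table row of an object. [cite: AroraBarak2009, §1.3] -/
theorem codeFP_wedgesRow : CodeFP OE (rawE (pairE refE (pairE refE (rawE ptE)))) (fun o => wedgesTbl.getD o.2.1 []) :=
  (rawGetD (rawE (pairE refE (pairE refE (rawE ptE)))) (d := []) rfl).comp ((const _ wedgesTbl).pair (snd _ _).fst')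

/-- **`overtsN` is computable.** [cite: AroraBarak2009, §1.3] -/
theorem codeFP_overtsN : CodeFP OE (rawE natE) (fun o => overtsN o.1 o.2) := by
  have hitem : CodeFP (pairE OE (pairE refE ptE)) natE (fun q => gnameN q.1.1 q.1.2.2.1 q.1.2.2.2 q.2.1) :=
    (codeFP_gnameO.comp ((fst _ _).pair (snd _ _).fst')).congr fun _ => rfl
  exact ((map (σ := CNF ℕ × ℕ × ℕ × ℕ) (eσ := OE) hitem).comp ((CodeFP.id _).pair codeFP_vertsRow)).congr fun o => by
    unfold overtsN; rfl

/-- **`ovposN` is computable.** [cite: AroraBarak2009, §1.3] -/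
theorem codeFP_ovposN : CodeFP OE (rawE (pairE natE ptE)) (fun o => ovposN o.1 o.2) := by
  have hn : CodeFP (pairE OE (pairE refE ptE)) natE (fun q => gnameN q.1.1 q.1.2.2.1 q.1.2.2.2 q.2.1) :=
    (codeFP_gnameO.comp ((fst _ _).pair (snd _ _).fst')).congr fun _ => rfl
  have hs : CodeFP (pairE OE (pairE refE ptE)) ptE (fun q => shiftPt (anchor q.1.1 q.1.2.2.1 q.1.2.2.2) q.2.2) :=
    (codeFP_shift.comp ((fst _ _).pair (snd _ _).snd')).congr fun _ => rfl
  exact ((map (σ := CNF ℕ × ℕ × ℕ × ℕ) (eσ := OE) (hn.pair hs)).comp ((CodeFP.id _).pair codeFP_vertsRow)).congr fun o => by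
    unfold ovposN; rfl

/-- **`oedgesN` is computable.** [cite: AroraBarak2009, §1.3] -/
theorem codeFP_oedgesN : CodeFP OE (rawE (pairE natE (pairE natE (rawE ptE)))) (fun o => oedgesN o.1 o.2) := by
  -- item context: (object, edge row entry)
  have h1 : CodeFP (pairE OE (pairE refE (pairE refE (rawE ptE)))) natE (fun q => gnameN q.1.1 q.1.2.2.1 q.1.2.2.2 q.2.1) :=
    (codeFP_gnameO.comp ((fst _ _).pair (snd _ _).fst')).congr fun _ => rfl
  have h2 : CodeFP (pairE OE (pairE refE (pairE refE (rawE ptE)))) natE (fun q => gnameN q.1.1 q.1.2.2.1 q.1.2.2.2 q.2.2.1) :=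
    (codeFP_gnameO.comp ((fst _ _).pair (snd _ _).snd'.fst')).congr fun _ => rfl
  -- the path: an inner map over the points with the object as context
  have hpt : CodeFP (pairE OE ptE) ptE (fun q => shiftPt (anchor q.1.1 q.1.2.2.1 q.1.2.2.2) q.2) := codeFP_shift
  have hpath : CodeFP (pairE OE (pairE refE (pairE refE (rawE ptE)))) (rawE ptE)
      (fun q => q.2.2.2.map (shiftPt (anchor q.1.1 q.1.2.2.1 q.1.2.2.2))) :=
    ((map (σ := CNF ℕ × ℕ × ℕ × ℕ) (eσ := OE) hpt).comp ((fst _ _).pair (snd _ _).snd'.snd')).congr fun _ => rfl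
  exact ((map (σ := CNF ℕ × ℕ × ℕ × ℕ) (eσ := OE) (h1.pair (h2.pair hpath))).comp
    ((CodeFP.id _).pair codeFP_wedgesRow)).congr fun o => by
    unfold oedgesN; rfl

end Objects

/-! ### The return paths -/

section Returns

/-- Scaling a unary numeral by a constant. [cite: AroraBarak2009, §1.3] -/
theorem unMulConst (c : ℕ) : CodeFP unE unE (fun n => c * n) := by
  induction c with
  | zero => exact (const _ 0).congr fun n => by simp
  | succ c ih => exact (unAdd.comp (ih.pair (CodeFP.id _))).congr fun n => by simp [Nat.succ_mul]

/-- **A unit-step segment with a budget** `u` on the number of steps (`seg` with every range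
capped at `u`). [folklore] -/
def segB (u : ℕ) (p q : GridPoint) : List GridPoint :=
  (if p.1 ≤ q.1 then (List.range (min (q.1 - p.1).toNat u)).map fun n => (p.1 + (n + 1 : ℕ), p.2)
    else (List.range (min (p.1 - q.1).toNat u)).map fun n => (p.1 - (n + 1 : ℕ), p.2)) ++
  (if p.2 ≤ q.2 then (List.range (min (q.2 - p.2).toNat u)).map fun n => (q.1, p.2 + (n + 1 : ℕ))
    else (List.range (min (p.2 - q.2).toNat u)).map fun n => (q.1, p.2 - (n + 1 : ℕ)))

/-- Within budget, `segB` is `seg`. [folklore] -/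
theorem segB_eq {u : ℕ} {p q : GridPoint} (h1 : (q.1 - p.1).natAbs ≤ u) (h2 : (q.2 - p.2).natAbs ≤ u) :
    segB u p q = seg p q := by
  have e1 : min (q.1 - p.1).toNat u = (q.1 - p.1).toNat := min_eq_left (by omega)
  have e2 : min (p.1 - q.1).toNat u = (p.1 - q.1).toNat := min_eq_left (by omega)
  have e3 : min (q.2 - p.2).toNat u = (q.2 - p.2).toNat := min_eq_left (by omega)
  have e4 : min (p.2 - q.2).toNat u = (p.2 - q.2).toNat := min_eq_left (by omega)
  unfold segB seg
  rw [e1, e2, e3, e4]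

/-- **`segB` is computable** (context: the budget in unary and the two ends). [cite: AroraBarak2009, §1.3] -/
theorem codeFP_segB : CodeFP (pairE unE (pairE ptE ptE)) (rawE ptE) (fun t => segB t.1 t.2.1 t.2.2) := by
  -- context σ = (u, p, q); items n
  have hu : CodeFP (pairE unE (pairE ptE ptE)) unE (fun t => t.1) := fst _ _
  have hp1 : CodeFP (pairE unE (pairE ptE ptE)) intE (fun t => t.2.1.1) := (snd _ _).fst'.fst'
  have hp2 : CodeFP (pairE unE (pairE ptE ptE)) intE (fun t => t.2.1.2) := (snd _ _).fst'.snd'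
  have hq1 : CodeFP (pairE unE (pairE ptE ptE)) intE (fun t => t.2.2.1) := (snd _ _).snd'.fst'
  have hq2 : CodeFP (pairE unE (pairE ptE ptE)) intE (fun t => t.2.2.2) := (snd _ _).snd'.snd'
  -- the four ranges
  have hr : ∀ {f : ℕ × GridPoint × GridPoint → ℤ}, CodeFP (pairE unE (pairE ptE ptE)) intE f →
      CodeFP (pairE unE (pairE ptE ptE)) (rawE natE) (fun t => List.range (min (f t).toNat t.1)) := fun hf =>
    (rangeOf.comp (hu.pair (intToNat.comp hf))).congr fun _ => rfl
  have hd1 := hr (f := fun t => t.2.2.1 - t.2.1.1) ((intSub.comp (hq1.pair hp1)).congr fun _ => rfl)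
  have hd2 := hr (f := fun t => t.2.1.1 - t.2.2.1) ((intSub.comp (hp1.pair hq1)).congr fun _ => rfl)
  have hd3 := hr (f := fun t => t.2.2.2 - t.2.1.2) ((intSub.comp (hq2.pair hp2)).congr fun _ => rfl)
  have hd4 := hr (f := fun t => t.2.1.2 - t.2.2.2) ((intSub.comp (hp2.pair hq2)).congr fun _ => rfl)
  -- the four item maps (context t, item n)
  have hn1 : CodeFP (pairE (pairE unE (pairE ptE ptE)) natE) intE (fun q => ((q.2 + 1 : ℕ) : ℤ)) :=
    (intOfNat.comp (natAdd.comp ((snd _ _).pair (const _ 1)))).congr fun _ => rfl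
  have cp1 : CodeFP (pairE (pairE unE (pairE ptE ptE)) natE) intE (fun q => q.1.2.1.1) := (fst _ _).snd'.fst'.fst'
  have cp2 : CodeFP (pairE (pairE unE (pairE ptE ptE)) natE) intE (fun q => q.1.2.1.2) := (fst _ _).snd'.fst'.snd'
  have cq1 : CodeFP (pairE (pairE unE (pairE ptE ptE)) natE) intE (fun q => q.1.2.2.1) := (fst _ _).snd'.snd'.fst'
  have i1 : CodeFP (pairE (pairE unE (pairE ptE ptE)) natE) ptE (fun q => (q.1.2.1.1 + ((q.2 + 1 : ℕ) : ℤ), q.1.2.1.2)) :=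
    (((intAdd.comp (cp1.pair hn1)).congr fun _ => rfl).pair cp2).congr fun _ => rfl
  have i2 : CodeFP (pairE (pairE unE (pairE ptE ptE)) natE) ptE (fun q => (q.1.2.1.1 - ((q.2 + 1 : ℕ) : ℤ), q.1.2.1.2)) :=
    (((intSub.comp (cp1.pair hn1)).congr fun _ => rfl).pair cp2).congr fun _ => rfl
  have i3 : CodeFP (pairE (pairE unE (pairE ptE ptE)) natE) ptE (fun q => (q.1.2.2.1, q.1.2.1.2 + ((q.2 + 1 : ℕ) : ℤ))) :=
    (cq1.pair ((intAdd.comp (cp2.pair hn1)).congr fun _ => rfl)).congr fun _ => rfl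
  have i4 : CodeFP (pairE (pairE unE (pairE ptE ptE)) natE) ptE (fun q => (q.1.2.2.1, q.1.2.1.2 - ((q.2 + 1 : ℕ) : ℤ))) :=
    (cq1.pair ((intSub.comp (cp2.pair hn1)).congr fun _ => rfl)).congr fun _ => rfl
  have m1 := (map (σ := ℕ × GridPoint × GridPoint) (eσ := pairE unE (pairE ptE ptE)) i1).comp ((CodeFP.id _).pair hd1)
  have m2 := (map (σ := ℕ × GridPoint × GridPoint) (eσ := pairE unE (pairE ptE ptE)) i2).comp ((CodeFP.id _).pair hd2)
  have m3 := (map (σ := ℕ × GridPoint × GridPoint) (eσ := pairE unE (pairE ptE ptE)) i3).comp ((CodeFP.id _).pair hd3)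
  have m4 := (map (σ := ℕ × GridPoint × GridPoint) (eσ := pairE unE (pairE ptE ptE)) i4).comp ((CodeFP.id _).pair hd4)
  have c1 : CodeFP (pairE unE (pairE ptE ptE)) bitE (fun t => decide (t.2.1.1 ≤ t.2.2.1)) := (intLe.comp (hp1.pair hq1)).congr fun _ => rfl
  have c2 : CodeFP (pairE unE (pairE ptE ptE)) bitE (fun t => decide (t.2.1.2 ≤ t.2.2.2)) := (intLe.comp (hp2.pair hq2)).congr fun _ => rfl
  exact ((rawAppend ptE).comp ((c1.ite m1 m2).pair (c2.ite m3 m4))).congr fun t => by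
    unfold segB; simp only [decide_eq_true_eq]; rfl

/-- The rectilinear path through six corners, with a budget. [folklore] -/
def poly6B (u : ℕ) (c : GridPoint × GridPoint × GridPoint × GridPoint × GridPoint × GridPoint) : List GridPoint :=
  c.1 :: (segB u c.1 c.2.1 ++ (segB u c.2.1 c.2.2.1 ++ (segB u c.2.2.1 c.2.2.2.1 ++
    (segB u c.2.2.2.1 c.2.2.2.2.1 ++ segB u c.2.2.2.2.1 c.2.2.2.2.2))))

/-- Within budget, `poly6B` is `poly` of the six corners. [folklore] -/
theorem poly6B_eq {u : ℕ} {c : GridPoint × GridPoint × GridPoint × GridPoint × GridPoint × GridPoint} {B : ℤ}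
    (hB : B.toNat ≤ u)
    (h0 : 0 ≤ c.1.1 ∧ c.1.1 ≤ B ∧ 0 ≤ c.1.2 ∧ c.1.2 ≤ B) (h1 : 0 ≤ c.2.1.1 ∧ c.2.1.1 ≤ B ∧ 0 ≤ c.2.1.2 ∧ c.2.1.2 ≤ B)
    (h2 : 0 ≤ c.2.2.1.1 ∧ c.2.2.1.1 ≤ B ∧ 0 ≤ c.2.2.1.2 ∧ c.2.2.1.2 ≤ B)
    (h3 : 0 ≤ c.2.2.2.1.1 ∧ c.2.2.2.1.1 ≤ B ∧ 0 ≤ c.2.2.2.1.2 ∧ c.2.2.2.1.2 ≤ B)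
    (h4 : 0 ≤ c.2.2.2.2.1.1 ∧ c.2.2.2.2.1.1 ≤ B ∧ 0 ≤ c.2.2.2.2.1.2 ∧ c.2.2.2.2.1.2 ≤ B)
    (h5 : 0 ≤ c.2.2.2.2.2.1 ∧ c.2.2.2.2.2.1 ≤ B ∧ 0 ≤ c.2.2.2.2.2.2 ∧ c.2.2.2.2.2.2 ≤ B) :
    poly6B u c = poly [c.1, c.2.1, c.2.2.1, c.2.2.2.1, c.2.2.2.2.1, c.2.2.2.2.2] := by
  have key : ∀ x y : ℤ, 0 ≤ x → x ≤ B → 0 ≤ y → y ≤ B → (x - y).natAbs ≤ u := by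
    intro x y hx hxB hy hyB; omega
  unfold poly6B
  simp only [poly, poly.go, List.append_nil]
  rw [segB_eq (key _ _ h1.1 h1.2.1 h0.1 h0.2.1) (key _ _ h1.2.2.1 h1.2.2.2 h0.2.2.1 h0.2.2.2),
    segB_eq (key _ _ h2.1 h2.2.1 h1.1 h1.2.1) (key _ _ h2.2.2.1 h2.2.2.2 h1.2.2.1 h1.2.2.2),
    segB_eq (key _ _ h3.1 h3.2.1 h2.1 h2.2.1) (key _ _ h3.2.2.1 h3.2.2.2 h2.2.2.1 h2.2.2.2),
    segB_eq (key _ _ h4.1 h4.2.1 h3.1 h3.2.1) (key _ _ h4.2.2.1 h4.2.2.2 h3.2.2.1 h3.2.2.2),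
    segB_eq (key _ _ h5.1 h5.2.1 h4.1 h4.2.1) (key _ _ h5.2.2.1 h5.2.2.2 h4.2.2.1 h4.2.2.2)]

/-- **`poly6B` is computable.** [cite: AroraBarak2009, §1.3] -/
theorem codeFP_poly6B : CodeFP (pairE unE (pairE ptE (pairE ptE (pairE ptE (pairE ptE (pairE ptE ptE))))))
    (rawE ptE) (fun t => poly6B t.1 t.2) := by
  have hu : CodeFP (pairE unE (pairE ptE (pairE ptE (pairE ptE (pairE ptE (pairE ptE ptE)))))) unE (fun t => t.1) := fst _ _
  have c0 : CodeFP (pairE unE (pairE ptE (pairE ptE (pairE ptE (pairE ptE (pairE ptE ptE)))))) ptE (fun t => t.2.1) := (snd _ _).fst'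
  have c1 : CodeFP (pairE unE (pairE ptE (pairE ptE (pairE ptE (pairE ptE (pairE ptE ptE)))))) ptE (fun t => t.2.2.1) := (snd _ _).snd'.fst'
  have c2 : CodeFP (pairE unE (pairE ptE (pairE ptE (pairE ptE (pairE ptE (pairE ptE ptE)))))) ptE (fun t => t.2.2.2.1) :=
    (snd _ _).snd'.snd'.fst'
  have c3 : CodeFP (pairE unE (pairE ptE (pairE ptE (pairE ptE (pairE ptE (pairE ptE ptE)))))) ptE (fun t => t.2.2.2.2.1) :=
    (snd _ _).snd'.snd'.snd'.fst'
  have c4 : CodeFP (pairE unE (pairE ptE (pairE ptE (pairE ptE (pairE ptE (pairE ptE ptE)))))) ptE (fun t => t.2.2.2.2.2.1) :=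
    (snd _ _).snd'.snd'.snd'.snd'.fst'
  have c5 : CodeFP (pairE unE (pairE ptE (pairE ptE (pairE ptE (pairE ptE (pairE ptE ptE)))))) ptE (fun t => t.2.2.2.2.2.2) :=
    (snd _ _).snd'.snd'.snd'.snd'.snd'
  have s01 := codeFP_segB.comp (hu.pair (c0.pair c1))
  have s12 := codeFP_segB.comp (hu.pair (c1.pair c2))
  have s23 := codeFP_segB.comp (hu.pair (c2.pair c3))
  have s34 := codeFP_segB.comp (hu.pair (c3.pair c4))
  have s45 := codeFP_segB.comp (hu.pair (c4.pair c5))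
  exact ((rawCons ptE).comp (c0.pair ((rawAppend ptE).comp (s01.pair ((rawAppend ptE).comp (s12.pair
    ((rawAppend ptE).comp (s23.pair ((rawAppend ptE).comp (s34.pair s45)))))))))).congr fun t => rfl

variable (ψ : CNF ℕ)

/-- The budget of the return paths: a bound on every coordinate of their corners. [folklore] -/
def retB : ℕ := 200 * (V ψ + 1) + 120 * (N ψ + 1)

/-- The six corners of the return path of row `i`. [folklore] -/
def retCorners6 (i : ℕ) : GridPoint × GridPoint × GridPoint × GridPoint × GridPoint × GridPoint :=
  let a := anchor ψ i (N ψ)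
  let b := anchor ψ (i + 1) 1
  let XR : ℤ := (4 * V ψ + 40 + 117 * (N ψ + 1) + 4 + 4 * (V ψ - i) : ℕ)
  let YB : ℤ := (2 + 4 * i : ℕ)
  let XL : ℤ := (2 + 4 * i : ℕ)
  ((a.1 + 107, a.2), (XR, a.2), (XR, YB), (XL, YB), (XL, b.2), (b.1 + 15, b.2))

/-- `retCorners` is the list of the components of `retCorners6`. [folklore] -/
theorem retCorners6_eq (i : ℕ) : retCorners ψ i =
    [(retCorners6 ψ i).1, (retCorners6 ψ i).2.1, (retCorners6 ψ i).2.2.1, (retCorners6 ψ i).2.2.2.1,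
      (retCorners6 ψ i).2.2.2.2.1, (retCorners6 ψ i).2.2.2.2.2] := rfl

/-- **The return edges through the budgeted paths.** [folklore] -/
def retEdgesN : List (SEdge ℕ) :=
  (List.range (V ψ)).map fun i => (retStart ψ i, retEnd ψ i, poly6B (retB ψ) (retCorners6 ψ i))

/-- The budgeted return edges are the return edges. [folklore] -/
theorem retEdgesN_eq : retEdgesN ψ = retEdges ψ := by
  unfold retEdgesN retEdges
  apply List.map_congr_left
  intro i hi
  rw [List.mem_range] at hi
  rw [retCorners6_eq]
  congr 2
  apply poly6B_eq (B := (retB ψ : ℤ)) (by simp)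
  all_goals
    simp only [retCorners6, anchor]
    unfold retB
    push_cast
    have hVi : ((V ψ - i : ℕ) : ℤ) ≤ V ψ := by exact_mod_cast Nat.sub_le _ _
    have hVi1 : ((V ψ - (i + 1) : ℕ) : ℤ) ≤ V ψ := by exact_mod_cast Nat.sub_le _ _
    refine ⟨by positivity, by nlinarith [hVi, hVi1], by positivity, by nlinarith [hVi, hVi1]⟩

/-- The code of the pair context `(ψ, i)`. -/
local notation "E2" => pairE cnfC natE

/-- **The six corners are computable.** [cite: AroraBarak2009, §1.3] -/
theorem codeFP_retCorners6 : CodeFP E2 (pairE ptE (pairE ptE (pairE ptE (pairE ptE (pairE ptE ptE)))))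
    (fun p => retCorners6 p.1 p.2) := by
  have hψ : CodeFP E2 cnfC (fun p => p.1) := fst _ _
  have hi : CodeFP E2 natE (fun p => p.2) := snd _ _
  have hV : CodeFP E2 natE (fun p => V p.1) := (codeFP_V.comp hψ).congr fun _ => rfl
  have hN : CodeFP E2 natE (fun p => N p.1) := (codeFP_N.comp hψ).congr fun _ => rfl
  have ha : CodeFP E2 ptE (fun p => anchor p.1 p.2 (N p.1)) := (codeFP_anchor.comp (hψ.pair (hi.pair hN))).congr fun _ => rfl
  have hb : CodeFP E2 ptE (fun p => anchor p.1 (p.2 + 1) 1) :=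
    (codeFP_anchor.comp (hψ.pair ((natAdd.comp (hi.pair (const _ 1))).pair (const _ 1)))).congr fun _ => rfl
  have hXRn : CodeFP E2 natE (fun p => 4 * V p.1 + 40 + 117 * (N p.1 + 1) + 4 + 4 * (V p.1 - p.2)) :=
    (natAdd.comp ((natAdd.comp ((natAdd.comp ((natAdd.comp ((natMul.comp ((const _ 4).pair hV)).pair (const _ 40))).pair
      (natMul.comp ((const _ 117).pair (natAdd.comp (hN.pair (const _ 1))))))).pair (const _ 4))).pair
      (natMul.comp ((const _ 4).pair (natSub.comp (hV.pair hi)))))).congr fun _ => rfl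
  have hXR : CodeFP E2 intE (fun p => ((4 * V p.1 + 40 + 117 * (N p.1 + 1) + 4 + 4 * (V p.1 - p.2) : ℕ) : ℤ)) :=
    (intOfNat.comp hXRn).congr fun _ => rfl
  have hYB : CodeFP E2 intE (fun p => ((2 + 4 * p.2 : ℕ) : ℤ)) :=
    (intOfNat.comp (natAdd.comp ((const _ 2).pair (natMul.comp ((const _ 4).pair hi))))).congr fun _ => rfl
  have h107 : CodeFP E2 intE (fun p => (anchor p.1 p.2 (N p.1)).1 + 107) :=
    (intAdd.comp (ha.fst'.pair (const _ (107 : ℤ)))).congr fun _ => rfl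
  have h15 : CodeFP E2 intE (fun p => (anchor p.1 (p.2 + 1) 1).1 + 15) :=
    (intAdd.comp (hb.fst'.pair (const _ (15 : ℤ)))).congr fun _ => rfl
  exact ((h107.pair ha.snd').pair ((hXR.pair ha.snd').pair ((hXR.pair hYB).pair ((hYB.pair hYB).pair
    ((hYB.pair hb.snd').pair (h15.pair hb.snd')))))).congr fun p => by unfold retCorners6; rfl

/-- **The return edges are computable** (raw paths). [cite: AroraBarak2009, §1.3] -/
theorem codeFP_retEdgesN : CodeFP cnfC (rawE (pairE natE (pairE natE (rawE ptE)))) retEdgesN := by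
  have hψ : CodeFP E2 cnfC (fun p => p.1) := fst _ _
  have hi : CodeFP E2 natE (fun p => p.2) := snd _ _
  have hN1 : CodeFP E2 natE (fun p => N p.1 - 1) := natSub.comp ((codeFP_N.comp hψ).pair (const _ 1))
  have hk : CodeFP E2 natE (fun p => tileCell p.1 p.2 (N p.1 - 1) 2) :=
    (codeFP_tileCell.comp (hψ.pair (hi.pair (hN1.pair (const _ 2))))).congr fun _ => rfl
  have hs : CodeFP E2 natE (fun p => retStart p.1 p.2) :=
    (natAdd.comp ((natMul.comp ((const _ 17).pair hk)).pair (const _ 4))).congr fun p => by unfold retStart; rfl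
  have he : CodeFP E2 natE (fun p => retEnd p.1 p.2) :=
    (natMul.comp ((const _ 17).pair (natAdd.comp (hk.pair (const _ 1))))).congr fun p => by unfold retEnd; rfl
  have huB : CodeFP E2 unE (fun p => retB p.1) :=
    (unAdd.comp (((unMulConst 200).comp (unSucc.comp (codeFP_uV.comp hψ))).pair
      ((unMulConst 120).comp (unSucc.comp (codeFP_uN.comp hψ))))).congr fun p => by unfold retB; rfl
  have hpath : CodeFP E2 (rawE ptE) (fun p => poly6B (retB p.1) (retCorners6 p.1 p.2)) :=
    (codeFP_poly6B.comp (huB.pair codeFP_retCorners6)).congr fun _ => rfl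
  have hitem : CodeFP E2 (pairE natE (pairE natE (rawE ptE))) (fun p => (retStart p.1 p.2, retEnd p.1 p.2, poly6B (retB p.1) (retCorners6 p.1 p.2))) :=
    hs.pair (he.pair hpath)
  have hr : CodeFP cnfC (rawE natE) (fun ψ => List.range (V ψ)) := urange.comp codeFP_uV
  exact ((map (σ := CNF ℕ) (eσ := cnfC) hitem).comp ((CodeFP.id _).pair hr)).congr fun ψ => by unfold retEdgesN; rfl

end Returns

/-! ### Positions by lookup, and the assembly -/

section Assembly

variable (ψ : CNF ℕ)

/-- The (name, position) list through the tables. [folklore] -/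
def vposListN : List (ℕ × GridPoint) := (objsN ψ).flatMap (ovposN ψ)

/-- `vposListN` is `vposList`. [folklore] -/
theorem vposListN_eq : vposListN ψ = vposList ψ := by
  unfold vposListN vposList
  rw [objsN_eq, List.flatMap_map]
  congr 1
  funext o
  exact (ovpos_eq ψ o).symm

/-- The vertex list through the tables. [folklore] -/
def vertsN : List ℕ := (objsN ψ).flatMap (overtsN ψ)

/-- `vertsN` is the vertex list of the drawing. [folklore] -/
theorem vertsN_eq : vertsN ψ = (drawing ψ).verts := by
  unfold vertsN
  change _ = (objs ψ).flatMap (overts ψ)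
  rw [objsN_eq, List.flatMap_map]
  congr 1
  funext o
  exact (overts_eq ψ o).symm

/-- The edge list through the tables. [folklore] -/
def edgesN : List (SEdge ℕ) := (objsN ψ).flatMap (oedgesN ψ) ++ retEdgesN ψ

/-- `edgesN` is the edge list of the drawing. [folklore] -/
theorem edgesN_eq : edgesN ψ = (drawing ψ).edges := by
  unfold edgesN
  change _ = (objs ψ).flatMap (oedges ψ) ++ retEdges ψ
  rw [objsN_eq, List.flatMap_map, retEdgesN_eq]
  congr 1
  congr 1
  funext o
  exact (oedges_eq ψ o).symm

/-- `List.lookup` is `find?` on the key. [folklore] -/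
theorem lookup_eq_find? (v : ℕ) (l : List (ℕ × GridPoint)) : l.lookup v = (l.find? fun x => x.1 == v).map Prod.snd := by
  induction l with
  | nil => rfl
  | cons x l ih =>
    obtain ⟨a, b⟩ := x
    by_cases h : v = a
    · subst h; simp [List.lookup, List.find?]
    · have h1 : (v == a) = false := by simp [h]
      have h2 : (a == v) = false := by simp [Ne.symm h]
      simp only [List.lookup, h1, List.find?, h2]
      exact ih

/-- **The position lookup** `(l, v) ↦ ((l.lookup v).getD (0, 0))` is computable. [cite: AroraBarak2009, §1.3] -/
theorem codeFP_lookupPos : CodeFP (pairE (rawE (pairE natE ptE)) natE) ptE (fun p => (p.1.lookup p.2).getD (0, 0)) := by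
  -- find? with the key as context
  have hp : CodeFP (pairE natE (pairE natE ptE)) bitE (fun t => t.2.1 == t.1) :=
    (natEq.comp ((snd _ _).fst'.pair (fst _ _))).congr fun t => by
      simp only; rw [Bool.eq_iff_iff]; simp
  have hf : CodeFP (pairE natE (rawE (pairE natE ptE))) (optE (pairE natE ptE)) (fun q => q.2.find? fun x => x.1 == q.1) :=
    rawFind? hp
  have hk : CodeFP (pairE natE (optE (pairE natE ptE))) ptE (fun q => (q.2.map Prod.snd).getD (0, 0)) :=
    optCases (k := fun (_ : ℕ) (o : Option (ℕ × GridPoint)) => (o.map Prod.snd).getD (0, 0))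
      (const _ ((0 : ℤ), (0 : ℤ))) ((snd _ _).snd') (fun _ => rfl) (fun _ _ => rfl)
  have h := hk.comp ((fst _ _).pair hf)
  exact (h.comp ((snd _ _).pair (fst _ _))).congr fun p => by rw [lookup_eq_find?]

/-- **The positions of the drawn vertices are computable.** [cite: AroraBarak2009, §1.3] -/
theorem codeFP_positions : CodeFP cnfC (rawE ptE) (fun ψ => (drawing ψ).verts.map (drawing ψ).pos) := by
  have hl : CodeFP cnfC (rawE (pairE natE ptE)) vposListN :=
    ((flatten _).comp ((map (σ := CNF ℕ) (eσ := cnfC) codeFP_ovposN).comp ((CodeFP.id _).pair codeFP_objsN))).congr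
      fun ψ => by unfold vposListN; simp [List.flatMap_def]
  have hv : CodeFP cnfC (rawE natE) vertsN :=
    ((flatten _).comp ((map (σ := CNF ℕ) (eσ := cnfC) codeFP_overtsN).comp ((CodeFP.id _).pair codeFP_objsN))).congr
      fun ψ => by unfold vertsN; simp [List.flatMap_def]
  have hitem : CodeFP (pairE (rawE (pairE natE ptE)) natE) ptE (fun q => (q.1.lookup q.2).getD (0, 0)) := codeFP_lookupPos
  have hm := (map (σ := List (ℕ × GridPoint)) (eσ := rawE (pairE natE ptE)) hitem).comp (hl.pair hv)
  exact hm.congr fun ψ => by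
    rw [vertsN_eq, vposListN_eq]
    apply List.map_congr_left
    intro v _
    rfl

/-- `lastQ` in closed form. [folklore] -/
theorem lastQ_eq : lastQ (cellsOf ψ) = 17 * (ncells ψ - 1) + 1 + (if cellTyN (cellTyAt ψ (ncells ψ - 1)) = 2 then 15 else 3) := by
  unfold lastQ
  rw [length_cellsOf, cellTy_cellsOf ψ (by unfold ncells; omega)]
  cases cellTyAt ψ (ncells ψ - 1) <;> simp [GridCell.vtx, cellTyN, GridCell.CellTy.qIdx]

/-- **`lastQ` is computable.** [cite: AroraBarak2009, §1.3] -/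
theorem codeFP_lastQ : CodeFP cnfC natE (fun ψ => lastQ (cellsOf ψ)) := by
  have hk : CodeFP cnfC natE (fun ψ => ncells ψ - 1) := natSub.comp (codeFP_ncells.pair (const _ 1))
  have ht : CodeFP cnfC natE (fun ψ => cellTyN (cellTyAt ψ (ncells ψ - 1))) :=
    (codeFP_cellTyN.comp ((CodeFP.id _).pair hk)).congr fun _ => rfl
  have hq : CodeFP cnfC natE (fun ψ => if cellTyN (cellTyAt ψ (ncells ψ - 1)) = 2 then 15 else 3) :=
    (((natEq.comp (ht.pair (const _ 2))).congr fun _ => rfl).ite (const _ 15) (const _ 3)).congr fun ψ => by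
      simp only [decide_eq_true_eq]
  exact ((natAdd.comp ((natAdd.comp ((natMul.comp ((const _ 17).pair hk)).pair (const _ 1))).pair hq)).congr fun ψ => by
    rw [lastQ_eq])

/-- Integer points to the output code of grid points. [cite: AroraBarak2009, §1.3] -/
theorem codeFP_toGp : CodeFP ptE gpC (fun p => p) :=
  ((smOfInt.comp (fst _ _)).pair (smOfInt.comp (snd _ _))).congr fun _ => rfl

/-- **The drawing data of the graph of a formula is polynomial-time computable.**
[cite: LiskiewiczOgiharaToda2003, §4 (proof of Theorem 7: "E₀ is computable in polynomial time")] -/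
theorem codeFP_drawingData : CodeFP cnfC ndC
    (fun ψ => ((drawing ψ).verts, (drawing ψ).verts.map (drawing ψ).pos, (drawing ψ).edges, 0, lastQ (cellsOf ψ))) := by
  have hv : CodeFP cnfC (rawE natE) (fun ψ => (drawing ψ).verts) :=
    ((flatten _).comp ((map (σ := CNF ℕ) (eσ := cnfC) codeFP_overtsN).comp ((CodeFP.id _).pair codeFP_objsN))).congr
      fun ψ => by rw [← vertsN_eq]; unfold vertsN; simp [List.flatMap_def]
  have hp : CodeFP cnfC (rawE gpC) (fun ψ => (drawing ψ).verts.map (drawing ψ).pos) :=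
    ((map₀ codeFP_toGp).comp codeFP_positions).congr fun ψ => by simp
  -- edges: object edges and return edges, paths converted to the output code
  have hconv : CodeFP (pairE natE (pairE natE (rawE ptE))) sedgeC (fun e => (e.1, e.2.1, e.2.2.map fun p => p)) :=
    (fst _ _).pair ((snd _ _).fst'.pair ((map₀ codeFP_toGp).comp (snd _ _).snd'))
  have heN : CodeFP cnfC (rawE (pairE natE (pairE natE (rawE ptE)))) edgesN :=
    ((rawAppend _).comp ((((flatten _).comp ((map (σ := CNF ℕ) (eσ := cnfC) codeFP_oedgesN).comp
      ((CodeFP.id _).pair codeFP_objsN)))).pair codeFP_retEdgesN)).congr fun ψ => by unfold edgesN; simp [List.flatMap_def]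
  have he : CodeFP cnfC (rawE sedgeC) (fun ψ => (drawing ψ).edges) :=
    ((map₀ hconv).comp heN).congr fun ψ => by
      simp only [List.map_id', edgesN_eq]
  exact hv.pair (hp.pair (he.pair ((const _ 0).pair codeFP_lastQ)))

end Assembly

end FormulaDrawing

end Literature.Barriers.CriticalPhenomena.GridSAW
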